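import Summits.ABC.IUTFork.Thm311RealInd1StripTwistPlanesJW
import HarnessLib

/-!
# [IUTchIII] Thm 3.11 (i) (Ind1) at `v ∈ 𝕍^non`: the GROUP generated by the realised Jannsen–Wingberg twists has UNIFORMLY
# BOUNDED orbits — (Ind1)-inflation from the twists is finite at each place (honest upper bound)

PROOF-ONLY file (abc-iut cell, Cor. 3.12 sub-crew, seat abc-iut-c312-1 = holder of record of the typed [IUTchIII] Thm. 3.11,
gen 10; row «R11 IND1-STRIP-MOVER-ALL-PLANES», part g).  TAKES NO SIDE on [IUTchIII] Cor. 3.12.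

Lower bounds (gen 9 / gen 10): the realised twists inflate an ideal-shaped region in every window of `e(v|p)+1` balls (`f(v|p)` odd,
p481941 / p482234).  This file is the honest COUNTERWEIGHT: the whole subgroup of additive automorphisms generated by the `2g`
transvections `x ↦ x + cb i x • ya i`, `x ↦ x − ca i x • yb i` of a Kronecker family of twist planes (K. Kondo arXiv:2512.09231 §2;
Jannsen–Wingberg NSW Thm. 7.5.14) acts on the plane coordinates through integral `2×2` matrices of each plane and trivially on
the plane-free remainder, so it has TWO INVARIANTS (`twistInvariants_of_transvection_add/sub`, `twistInvariants_closure`):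
* the plane-free remainder `x − Σ_i (ca i x • ya i + cb i x • yb i)`, and
* for every plane `j`, the max-norm of the plane coordinates `max ‖ca j x‖ ‖cb j x‖` (ultrametric field of scalars).
Consequently (**`norm_apply_le_of_mem_closure`**) every element `γ` of the generated group maps each `x` into any ball `B(0,r)`
containing `x` and the `4g` numbers `‖c x‖·‖y‖` (`c ∈ {ca j, cb j}`, `y ∈ {ya j, yb j}`) — the orbit of a ball under the twist
group is BOUNDED, by a radius depending only on the plane data (if the planes are SHORT in the sense of
`Thm311RealInd1StripTwistOrthogonality`, by the ball itself).  §2 AT THE REAL LOG-SHELL (**`Real.norm_apply_le_of_mem_closure_planes`**):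
for the planes realised in print's (Ind1) strip part by `DehnTwistTransvectionsOnUnitsAll` (`exists_realised_planes_of_dehnTwistsAll`,
p482234), every element of the subgroup of `AddAut(K_v)` generated by the `ψ i, ψ' i` obeys the same bound on `K_v` (rescaled norm).
So the (Ind1)-inflation obtainable from the Jannsen–Wingberg twists is FINITE at each place, uniformly in the radius; nothing is
claimed here about the rest of `Aut_top(G_v)`.  Classical ultrametric linear algebra; [claim: Mochizuki2012, status: disputed] for
every [IUTchIII] quotation; [cite: NeukirchSchmidtWingberg2008, Thm 7.5.14]; [cite: Kondo2025OuterAutMLF, §2 Thm 2.1 and proof of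
Thm 2.3 p.10]; [cite: DupuyHilado2025, §4.7].  typed ≠ proved; a conditional theorem discharges nothing it binds.
-/

set_option autoImplicit false

noncomputable section

open Metric Set

namespace Summit.ABC.IUTFork.Thm311.TwistLattice

/-! ## 1. The two invariants of the twist group and the orbit bound -/

section Bounded

variable {𝕜 : Type*} [NormedField 𝕜] [IsUltrametricDist 𝕜]
variable {K : Type*} [NontriviallyNormedField K] [NormedAlgebra 𝕜 K] [IsUltrametricDist K]
variable {ι : Type*} [Fintype ι] [DecidableEq ι]
variable {ca cb : ι → (K →ₗ[𝕜] 𝕜)} {ya yb : ι → K}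
variable (haa : ∀ i j, ca i (ya j) = if i = j then 1 else 0) (hbb : ∀ i j, cb i (yb j) = if i = j then 1 else 0)
variable (hab : ∀ i j, ca i (yb j) = 0) (hba : ∀ i j, cb i (ya j) = 0)

omit [IsUltrametricDist K] in
/-- Ultrametric `2×2` bookkeeping: `max ‖α + β‖ ‖β‖ = max ‖α‖ ‖β‖`. [folklore] -/
theorem max_norm_add_right_eq (α β : 𝕜) : max ‖α + β‖ ‖β‖ = max ‖α‖ ‖β‖ := by
  apply le_antisymm
  · exact max_le (IsUltrametricDist.norm_add_le_max α β) (le_max_right _ _)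
  · refine max_le ?_ (le_max_right _ _)
    calc ‖α‖ = ‖(α + β) + -β‖ := by rw [add_neg_cancel_right]
      _ ≤ max ‖α + β‖ ‖-β‖ := IsUltrametricDist.norm_add_le_max _ _
      _ = max ‖α + β‖ ‖β‖ := by rw [norm_neg]

omit [IsUltrametricDist K] in
/-- Ultrametric `2×2` bookkeeping: `max ‖α‖ ‖β − α‖ = max ‖α‖ ‖β‖`. [folklore] -/
theorem max_norm_sub_left_eq (α β : 𝕜) : max ‖α‖ ‖β - α‖ = max ‖α‖ ‖β‖ := by
  apply le_antisymm
  · refine max_le (le_max_left _ _) ?_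
    calc ‖β - α‖ = ‖β + -α‖ := by rw [sub_eq_add_neg]
      _ ≤ max ‖β‖ ‖-α‖ := IsUltrametricDist.norm_add_le_max _ _
      _ ≤ max ‖α‖ ‖β‖ := by rw [norm_neg, max_comm]
  · refine max_le (le_max_left _ _) ?_
    calc ‖β‖ = ‖(β - α) + α‖ := by rw [sub_add_cancel]
      _ ≤ max ‖β - α‖ ‖α‖ := IsUltrametricDist.norm_add_le_max _ _
      _ ≤ max ‖α‖ ‖β - α‖ := by rw [max_comm]

omit [IsUltrametricDist K] in
include haa hba in
/-- **The transvection `x ↦ x + cb i x • ya i` preserves both invariants**: the plane-free remainder and every plane's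
coordinate max-norm. [folklore] -/
theorem twistInvariants_of_transvection_add {𝔊 : Type*} [AddGroup 𝔊] (ρ : 𝔊 →+ AddAut K) (i : ι) {T : 𝔊}
    (hT : ∀ x, ρ T x = x + cb i x • ya i) (x : K) :
    (ρ T x - ∑ j, (ca j (ρ T x) • ya j + cb j (ρ T x) • yb j) = x - ∑ j, (ca j x • ya j + cb j x • yb j)) ∧
      ∀ j, max ‖ca j (ρ T x)‖ ‖cb j (ρ T x)‖ = max ‖ca j x‖ ‖cb j x‖ := by
  have hca : ∀ j, ca j (ρ T x) = ca j x + (if j = i then cb i x else 0) := by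
    intro j
    rw [hT, map_add, map_smul, haa, smul_eq_mul, mul_ite, mul_one, mul_zero]
  have hcb : ∀ j, cb j (ρ T x) = cb j x := by
    intro j
    rw [hT, map_add, map_smul, hba, smul_zero, add_zero]
  refine ⟨?_, fun j => ?_⟩
  · have hsum : ∑ j, (ca j (ρ T x) • ya j + cb j (ρ T x) • yb j) =
        ∑ j, (ca j x • ya j + cb j x • yb j) + cb i x • ya i := by
      simp only [hca, hcb, add_smul, ite_smul, zero_smul]
      rw [Finset.sum_add_distrib, Finset.sum_add_distrib, Finset.sum_add_distrib, Finset.sum_ite_eq' Finset.univ i,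
        if_pos (Finset.mem_univ i)]
      abel
    rw [hsum, hT]
    abel
  · rw [hca, hcb]
    by_cases hji : j = i
    · subst hji
      rw [if_pos rfl]
      exact max_norm_add_right_eq _ _
    · rw [if_neg hji, add_zero]

omit [IsUltrametricDist K] in
include hbb hab in
/-- **The transvection `x ↦ x − ca i x • yb i` preserves both invariants.** [folklore] -/
theorem twistInvariants_of_transvection_sub {𝔊 : Type*} [AddGroup 𝔊] (ρ : 𝔊 →+ AddAut K) (i : ι) {T : 𝔊}
    (hT : ∀ x, ρ T x = x - ca i x • yb i) (x : K) :
    (ρ T x - ∑ j, (ca j (ρ T x) • ya j + cb j (ρ T x) • yb j) = x - ∑ j, (ca j x • ya j + cb j x • yb j)) ∧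
      ∀ j, max ‖ca j (ρ T x)‖ ‖cb j (ρ T x)‖ = max ‖ca j x‖ ‖cb j x‖ := by
  have hcb : ∀ j, cb j (ρ T x) = cb j x - (if j = i then ca i x else 0) := by
    intro j
    rw [hT, map_sub, map_smul, hbb, smul_eq_mul, mul_ite, mul_one, mul_zero]
  have hca : ∀ j, ca j (ρ T x) = ca j x := by
    intro j
    rw [hT, map_sub, map_smul, hab, smul_zero, sub_zero]
  refine ⟨?_, fun j => ?_⟩
  · have hsum : ∑ j, (ca j (ρ T x) • ya j + cb j (ρ T x) • yb j) =
        ∑ j, (ca j x • ya j + cb j x • yb j) - ca i x • yb i := by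
      simp only [hca, hcb, sub_smul, ite_smul, zero_smul]
      rw [Finset.sum_add_distrib, Finset.sum_add_distrib, Finset.sum_sub_distrib, Finset.sum_ite_eq' Finset.univ i,
        if_pos (Finset.mem_univ i)]
      abel
    rw [hsum, hT]
    abel
  · rw [hca, hcb]
    by_cases hji : j = i
    · subst hji
      rw [if_pos rfl]
      exact max_norm_sub_left_eq _ _
    · rw [if_neg hji, sub_zero]

omit [Fintype ι] [DecidableEq ι] [IsUltrametricDist 𝕜] [IsUltrametricDist K] in
/-- **Closure**: if every generator in `S` preserves the two invariants (through a representation `ρ : 𝔊 →+ AddAut K`), so does every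
element of the subgroup generated by `S`. [folklore] -/
theorem twistInvariants_closure [Fintype ι] {𝔊 : Type*} [AddGroup 𝔊] (ρ : 𝔊 →+ AddAut K) {S : Set 𝔊}
    (hS : ∀ γ ∈ S, ∀ x : K,
      (ρ γ x - ∑ j, (ca j (ρ γ x) • ya j + cb j (ρ γ x) • yb j) = x - ∑ j, (ca j x • ya j + cb j x • yb j)) ∧
        ∀ j, max ‖ca j (ρ γ x)‖ ‖cb j (ρ γ x)‖ = max ‖ca j x‖ ‖cb j x‖)
    {γ : 𝔊} (hγ : γ ∈ AddSubgroup.closure S) (x : K) :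
    (ρ γ x - ∑ j, (ca j (ρ γ x) • ya j + cb j (ρ γ x) • yb j) = x - ∑ j, (ca j x • ya j + cb j x • yb j)) ∧
      ∀ j, max ‖ca j (ρ γ x)‖ ‖cb j (ρ γ x)‖ = max ‖ca j x‖ ‖cb j x‖ := by
  induction hγ using AddSubgroup.closure_induction generalizing x with
  | mem γ hγ => exact hS γ hγ x
  | zero => rw [map_zero, AddAut.zero_apply]; exact ⟨rfl, fun _ => rfl⟩
  | add γ δ _ _ ihγ ihδ =>
    rw [map_add, AddAut.add_apply]
    exact ⟨((ihγ (ρ δ x)).1).trans (ihδ x).1, fun j => ((ihγ (ρ δ x)).2 j).trans ((ihδ x).2 j)⟩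
  | neg γ _ ih =>
    have h := ih (ρ (-γ) x)
    rw [map_neg, AddAut.apply_neg_self] at h
    rw [map_neg]
    exact ⟨h.1.symm, fun j => (h.2 j).symm⟩

omit [DecidableEq ι] [IsUltrametricDist 𝕜] in
/-- **ORBIT BOUND.**  If every generator in `S` preserves the two twist invariants, then every element `γ` of the generated subgroup
maps each `x` into any ball `B(0, r)` that contains `x` and dominates the `4·#ι` numbers `‖c x‖·‖y‖` (`c ∈ {ca j, cb j}`,
`y ∈ {ya j, yb j}`): `‖γ x‖ ≤ r`.  (`γ x = remainder(x) + Σ_j (ca j (γx) • ya j + cb j (γx) • yb j)` with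
`max ‖ca j (γx)‖ ‖cb j (γx)‖ = max ‖ca j x‖ ‖cb j x‖`; ultrametric inequality.)  The orbit of a ball under the twist group is
BOUNDED. [folklore] -/
theorem norm_apply_le_of_mem_closure {𝔊 : Type*} [AddGroup 𝔊] (ρ : 𝔊 →+ AddAut K) {S : Set 𝔊}
    (hS : ∀ γ ∈ S, ∀ x : K,
      (ρ γ x - ∑ j, (ca j (ρ γ x) • ya j + cb j (ρ γ x) • yb j) = x - ∑ j, (ca j x • ya j + cb j x • yb j)) ∧
        ∀ j, max ‖ca j (ρ γ x)‖ ‖cb j (ρ γ x)‖ = max ‖ca j x‖ ‖cb j x‖)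
    {γ : 𝔊} (hγ : γ ∈ AddSubgroup.closure S) (x : K) {r : ℝ} (hx : ‖x‖ ≤ r)
    (hplanes : ∀ j, ‖ca j x‖ * ‖ya j‖ ≤ r ∧ ‖ca j x‖ * ‖yb j‖ ≤ r ∧ ‖cb j x‖ * ‖ya j‖ ≤ r ∧ ‖cb j x‖ * ‖yb j‖ ≤ r) :
    ‖ρ γ x‖ ≤ r := by
  classical
  have hr : 0 ≤ r := (norm_nonneg x).trans hx
  obtain ⟨hrem, hmax⟩ := twistInvariants_closure (ca := ca) (cb := cb) (ya := ya) (yb := yb) ρ hS hγ x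
  -- the plane components of `γ x` are dominated by `r`
  have hM : ∀ j, max ‖ca j (ρ γ x)‖ ‖cb j (ρ γ x)‖ * ‖ya j‖ ≤ r ∧ max ‖ca j (ρ γ x)‖ ‖cb j (ρ γ x)‖ * ‖yb j‖ ≤ r := by
    intro j
    obtain ⟨h1, h2, h3, h4⟩ := hplanes j
    rw [hmax j, max_mul_of_nonneg _ _ (norm_nonneg _), max_mul_of_nonneg _ _ (norm_nonneg _)]
    exact ⟨max_le h1 h3, max_le h2 h4⟩
  have hterm : ∀ j, ‖ca j (ρ γ x) • ya j + cb j (ρ γ x) • yb j‖ ≤ r := by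
    intro j
    refine (IsUltrametricDist.norm_add_le_max _ _).trans (max_le ?_ ?_)
    · rw [norm_smul]
      exact le_trans (mul_le_mul_of_nonneg_right (le_max_left _ _) (norm_nonneg _)) (hM j).1
    · rw [norm_smul]
      exact le_trans (mul_le_mul_of_nonneg_right (le_max_right _ _) (norm_nonneg _)) (hM j).2
  have hsumγ : ‖∑ j, (ca j (ρ γ x) • ya j + cb j (ρ γ x) • yb j)‖ ≤ r :=
    IsUltrametricDist.norm_sum_le_of_forall_le_of_nonneg hr fun j _ => hterm j
  -- the plane components of `x` itself are dominated by `r`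
  have hterm0 : ∀ j, ‖ca j x • ya j + cb j x • yb j‖ ≤ r := by
    intro j
    obtain ⟨h1, -, -, h4⟩ := hplanes j
    refine (IsUltrametricDist.norm_add_le_max _ _).trans (max_le ?_ ?_)
    · rw [norm_smul]; exact h1
    · rw [norm_smul]; exact h4
  have hsum0 : ‖∑ j, (ca j x • ya j + cb j x • yb j)‖ ≤ r :=
    IsUltrametricDist.norm_sum_le_of_forall_le_of_nonneg hr fun j _ => hterm0 j
  -- the remainder of `x` is dominated by `r`
  have hrem0 : ‖x - ∑ j, (ca j x • ya j + cb j x • yb j)‖ ≤ r := by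
    rw [sub_eq_add_neg]
    refine (IsUltrametricDist.norm_add_le_max _ _).trans (max_le hx ?_)
    rw [norm_neg]; exact hsum0
  -- `γ x = remainder(γ x) + planes(γ x) = remainder(x) + planes(γ x)`
  have hdecomp : ρ γ x = (x - ∑ j, (ca j x • ya j + cb j x • yb j)) + ∑ j, (ca j (ρ γ x) • ya j + cb j (ρ γ x) • yb j) := by
    rw [← hrem, sub_add_cancel]
  rw [hdecomp]
  exact (IsUltrametricDist.norm_add_le_max _ _).trans (max_le hrem0 hsumγ)

include haa hbb hab hba in
/-- **The twist group of a Kronecker family of planes has bounded orbits** (generators version): if `ψ i, ψ' i ∈ 𝔊` act through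
`ρ` as `x ↦ x + cb i x • ya i`, `x ↦ x − ca i x • yb i`, then every `γ` in the subgroup generated by them satisfies the orbit bound of
`norm_apply_le_of_mem_closure`. [folklore] -/
theorem norm_apply_le_of_mem_closure_transvections {𝔊 : Type*} [AddGroup 𝔊] (ρ : 𝔊 →+ AddAut K) {ψ ψ' : ι → 𝔊}
    (hT : ∀ i x, ρ (ψ i) x = x + cb i x • ya i) (hT' : ∀ i x, ρ (ψ' i) x = x - ca i x • yb i)
    {γ : 𝔊} (hγ : γ ∈ AddSubgroup.closure (Set.range ψ ∪ Set.range ψ')) (x : K) {r : ℝ} (hx : ‖x‖ ≤ r)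
    (hplanes : ∀ j, ‖ca j x‖ * ‖ya j‖ ≤ r ∧ ‖ca j x‖ * ‖yb j‖ ≤ r ∧ ‖cb j x‖ * ‖ya j‖ ≤ r ∧ ‖cb j x‖ * ‖yb j‖ ≤ r) :
    ‖ρ γ x‖ ≤ r := by
  refine norm_apply_le_of_mem_closure ρ (fun δ hδ y => ?_) hγ x hx hplanes
  rcases hδ with ⟨i, rfl⟩ | ⟨i, rfl⟩
  · exact twistInvariants_of_transvection_add haa hba ρ i (hT i) y
  · exact twistInvariants_of_transvection_sub hbb hab ρ i (hT' i) y

end Bounded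

end Summit.ABC.IUTFork.Thm311.TwistLattice

/-! ## 2. At the real log-shell `K_v`: the group generated by the realised Jannsen–Wingberg twists has bounded orbits -/

namespace Summit.ABC.IUTFork.Thm311.Real

open NumberField IsDedekindDomain Literature.NumberTheory.NumberFields Literature.IUT.LogVolume
open Literature.NumberTheory.GaloisRepresentations.Ultrametric Summit.ABC.IUTFork.Thm311.TwistLattice
open Literature.AnabelianGeometry.AbsoluteAnabelian

variable {F : Type} [Field F] [NumberField F] (v : HeightOneSpectrum (𝓞 F))

/-- Conjugation by the identity `of : K_v ≃+* K` (rescaled norm): the action of `AddAut(K_v)` on `K`, as a homomorphism.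
[folklore] -/
theorem exists_conj_hom (p : ℕ) [Fact p.Prime] (hv : ((p : ℕ) : 𝓞 F) ∈ v.asIdeal) :
    ∃ ρ : AddAut (v.adicCompletion F) →+ AddAut (RescaledCompletion F p v hv),
      ∀ γ x, ρ γ x = RescaledCompletion.of F p v hv (γ ((RescaledCompletion.of F p v hv).symm x)) := by
  refine ⟨AddMonoidHom.mk' (fun γ => ((RescaledCompletion.of F p v hv).symm.toAddEquiv.trans γ).trans
      (RescaledCompletion.of F p v hv).toAddEquiv) (fun γ δ => ?_), fun γ x => rfl⟩
  ext x
  change RescaledCompletion.of F p v hv ((γ + δ) ((RescaledCompletion.of F p v hv).symm x)) =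
    RescaledCompletion.of F p v hv (γ ((RescaledCompletion.of F p v hv).symm
      (RescaledCompletion.of F p v hv (δ ((RescaledCompletion.of F p v hv).symm x)))))
  rw [AddAut.add_apply, RingEquiv.symm_apply_apply]

/-- **THE REALISED TWIST GROUP HAS BOUNDED ORBITS ON `K_v` — (Ind1)-inflation from the Jannsen–Wingberg twists is FINITE at each
place.**  Assume `DehnTwistTransvectionsOnUnitsAll`, `p` odd, `[K_v : ℚ_p] ≥ 3`.  With the realised planes of
`exists_realised_planes_of_dehnTwistsAll` — `ψ i, ψ' i ∈ Real.ind1StripOf v (Real.galoisLog v)` acting on `K_v` (rescaled norm) as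
the `2g` transvections of a Kronecker family `(ya i, yb i; ca i, cb i)` —, EVERY element `γ` of the subgroup of `AddAut(K_v)`
generated by the `ψ i, ψ' i` maps each `x` into any ball `B(0,r)` containing `x` and dominating the `4g` numbers `‖c x‖·‖y‖`
(`c ∈ {ca j, cb j}`, `y ∈ {ya j, yb j}`).  In particular the orbit of every ideal-shaped region `𝔪_v^m` under this group is
bounded, by a radius depending on the planes only — the honest upper bound matching the lower bounds of record (p481941 /
p482234).  Nothing is claimed about the rest of `Aut_top(G_v)`. [claim: Mochizuki2012, status: disputed]
[cite: Kondo2025OuterAutMLF, §2 Thm 2.1 and proof of Thm 2.3 p.10] [cite: DupuyHilado2025, §4.7] -/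
theorem norm_apply_le_of_mem_closure_planes (hJW : DehnTwistTransvectionsOnUnitsAll)
    (p : ℕ) [Fact p.Prime] (hv : ((p : ℕ) : 𝓞 F) ∈ v.asIdeal) (hp2 : p ≠ 2) (h3 : 3 ≤ localDeg F v) :
    ∃ (g : ℕ) (ca cb : Fin g → (RescaledCompletion F p v hv →ₗ[ℚ_[p]] ℚ_[p])) (ya yb : Fin g → RescaledCompletion F p v hv)
      (ψ ψ' : Fin g → (v.adicCompletion F ≃+ v.adicCompletion F)),
      localDeg F v ≤ 2 + 2 * g ∧
      (∀ i, ψ i ∈ ind1StripOf v (galoisLog v)) ∧ (∀ i, ψ' i ∈ ind1StripOf v (galoisLog v)) ∧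
      (∀ i (x : RescaledCompletion F p v hv),
        RescaledCompletion.of F p v hv (ψ i ((RescaledCompletion.of F p v hv).symm x)) = x + cb i x • ya i) ∧
      (∀ i (x : RescaledCompletion F p v hv),
        RescaledCompletion.of F p v hv (ψ' i ((RescaledCompletion.of F p v hv).symm x)) = x - ca i x • yb i) ∧
      ∀ γ ∈ AddSubgroup.closure (Set.range ψ ∪ Set.range ψ'), ∀ (x : RescaledCompletion F p v hv) (r : ℝ),
        ‖x‖ ≤ r → (∀ j, ‖ca j x‖ * ‖ya j‖ ≤ r ∧ ‖ca j x‖ * ‖yb j‖ ≤ r ∧ ‖cb j x‖ * ‖ya j‖ ≤ r ∧ ‖cb j x‖ * ‖yb j‖ ≤ r) →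
          ‖RescaledCompletion.of F p v hv (γ ((RescaledCompletion.of F p v hv).symm x))‖ ≤ r := by
  classical
  obtain ⟨c, g, hc, hcard, ca, cb, ya, yb, ψ, ψ', haa, hbb, hab, hba, hψ, hψ', hT, hT'⟩ :=
    exists_realised_planes_of_dehnTwistsAll v hJW p hv hp2 h3
  obtain ⟨ρ, hρ⟩ := exists_conj_hom v p hv
  refine ⟨g, ca, cb, ya, yb, ψ, ψ', by omega, hψ, hψ', hT, hT', fun γ hγ x r hx hplanes => ?_⟩
  rw [← hρ]
  exact norm_apply_le_of_mem_closure_transvections haa hbb hab hba ρ (fun i y => by rw [hρ, hT])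
    (fun i y => by rw [hρ, hT']) hγ x hx hplanes

end Summit.ABC.IUTFork.Thm311.Real

end
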